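import Literature.NumberTheory.EllipticCurves.QuadraticTwistSelmerPInfty
import Literature.NumberTheory.EllipticCurves.IsogenyQuadraticTwistProofs
import Literature.NumberTheory.EllipticCurves.DiscreteH1Equiv
import Literature.NumberTheory.EllipticCurves.Selmer
import HarnessLib

/-!
# Route `GenusKolyvaginAtTwo`, crux #2 `GenusPrimitiveSupplyAtTwo` (stmt-BirchSwinnertonDyer-22136):
# Mazur–Rubin Lemma 2.10 (i) in tree currency — at a place where `d` is a square, the RELAXED local
# `2`-Selmer conditions of `E` and of every model of `E^{(d)}` correspond

Width seat `bsd-line-gk2-p5` g8 (cell `bsd-f1-sign2`, SUPPLY lineage). THEOREMS ONLY (no definition, no named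
fact, no `sorry`); helper `--supports stmt-BirchSwinnertonDyer-22136`; no item is closed; BSD is not proved by
any of this.

WHY. The SUPPLY half of crux #2 is kernel-closed modulo four BY-NAME facts — `MazurRubin2010.prop33_rat`,
`MazurRubin2010.cor34i_singleton_rat`, `F1Sign2.AdmissibleTwistSelmerShiftAtTwo` (T-A), `F1Sign2.StrictShaPropagationAtTwo`
(T-V) — all four of which are instances of ONE missing arithmetic instantiation of the tree's PROVED Klagsbrun–Mazur–Rubin
engine (`QuadraticSelmerStructure`, `finrank_selmerGroup_eq_of_transverse_of_le_one`): the Kummer local conditions of `E`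
and `E^{(d)}` as two families of subspaces of ONE `H¹(ℚ, E[2])` (Mazur–Rubin 2010, Remark 2.4: `E[2] = E^F[2]`).
The tree already has: the `Γ`-equivariant identification `E^{(d)}[2] ≃ E[2]` and the transport of the STRICT local
kernels (gk2-p4 g7, `GenusKolyTwistingPrime.exists_h1Map_of_equivariant_addEquiv`), and the vanishing of the
archimedean condition on `Δ < 0` (gk2-p3 g10). This file supplies the first FINITE-PLACE brick, Mazur–Rubin's
Lemma 2.10 (i) «`v` splits in `F/K` ⟹ `H¹_f(K_v, E[2]) = H¹_f(K_v, E^F[2])`», in the tree's currency of pulled-back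
local conditions `WeierstrassCurve.selmerLocalKer W E 2 = ker (H¹(K, E[2]) → H¹(E, E(K̄_E)))` (file `Selmer`):

* `exists_h1Equiv_selmerLocalKer_iff_of_sq` — for `W/K` (`2 ≠ 0` in `K`), `d ≠ 0`, ANY model `Wd = C • W^{(d)}`:
  there is a `Γ_K`-equivariant `ψ : Wd[2] ≃+ W[2]` such that for EVERY `K`-field `E` in which `d` is a square,
  `x ∈ selmerLocalKer Wd E 2 ↔ h1Equiv ψ x ∈ selmerLocalKer W E 2` — the relaxed local conditions at `E` of `W`
  and `Wd` coincide under `H¹(K, Wd[2]) ≃+ H¹(K, W[2])` (every prime of bad reduction, the prime `2` and the real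
  place SPLIT in the twisting fields the cell uses: Heegner fields, descent-admissible `d`).

MECHANISM (Silverman X.5 Cor. 5.4 over `K̄` AND over `K̄_E`, intertwined): the untwisting `(x,y) ↦ (x/θ², y/θ³)`,
`θ = √d ∈ K̄` (tree `untwistEquiv`, up to the changes of variables `C` and `W.toCharNeTwoNF`), is `Γ_K`-equivariant
UP TO SIGN on `E(K̄)`, hence equivariant on `E[2]`; the SAME substitution over `K̄_E` with `u := ι(θ)`, `ι : K̄ → K̄_E` the
chosen embedding, is `Γ_E`-equivariant on all of `E(K̄_E)` as soon as `d = s²` in `E` (`ι θ = ± s`), and the two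
commute with the maps on points along `ι` ON THE NOSE (same formula) — so the tree's transport lemma
`mem_resKer_iff_h1Equiv_mem` (file `DiscreteH1Equiv`) applies.

References: [MazurRubin2010] Remark 2.4, Lemma 2.10 (i); [SilvermanAEC2009] X.2 Prop. 2.4, X.5 Cor. 5.4, X.§4.
-/

set_option linter.dupNamespace false -- tree convention: `Summit.BirchSwinnertonDyer.BirchSwinnertonDyer.Theorems` (summit = sub-problem)
set_option autoImplicit false

noncomputable section

open scoped Classical

namespace Summit.BirchSwinnertonDyer.BirchSwinnertonDyer.Theorems.GenusKolyTwistLocal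

open WeierstrassCurve Field
open Literature.NumberTheory.EllipticCurves

universe u

/-! ## §1 The untwisting substitution over `K̄_E` -/

section LocalUntwist

variable {K : Type u} [Field K] [NeZero (2 : K)] (V : WeierstrassCurve K) [V.IsCharNeTwoNF] {d : K}
  (hd : d ≠ 0) (E : Type u) [Field E] [Algebra K E]

/-- **The untwisting substitution over `K̄_E`.** Mapping the `K̄`-substitution `C_θ = (θ, 0, 0, 0)`
(`untwist`, `θ = √d ∈ K̄`) along the chosen `K`-embedding `ι : K̄ → K̄_E` gives a change of variables over
`K̄_E` carrying `V^{(d)}` to `V` (for a model with `a₁ = a₃ = 0`): the image under `ι` of the tree's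
`untwist_smul_eq` (`map_variableChange`, `map_baseChange`). [cite: SilvermanAEC2009, X.5 Cor. 5.4] -/
theorem untwist_map_closureEmb_smul :
    (untwist hd).map (closureEmb (K := K) E : AlgebraicClosure K →+* AlgebraicClosure E) •
        (V.quadraticTwist d).baseChange (AlgebraicClosure E) =
      V.baseChange (AlgebraicClosure E) := by
  have h := congrArg (fun X : WeierstrassCurve (AlgebraicClosure K) ↦
    X.map (closureEmb (K := K) E : AlgebraicClosure K →+* AlgebraicClosure E)) (untwist_smul_eq V hd)
  rw [← map_variableChange] at h
  have h1 : ((V.quadraticTwist d).baseChange (AlgebraicClosure K)).map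
      (closureEmb (K := K) E : AlgebraicClosure K →+* AlgebraicClosure E) =
      (V.quadraticTwist d).baseChange (AlgebraicClosure E) :=
    map_baseChange (V.quadraticTwist d) (closureEmb (K := K) E)
  have h2 : (V.baseChange (AlgebraicClosure K)).map
      (closureEmb (K := K) E : AlgebraicClosure K →+* AlgebraicClosure E) =
      V.baseChange (AlgebraicClosure E) :=
    map_baseChange V (closureEmb (K := K) E)
  rw [h1, h2] at h
  exact h

omit [NeZero (2 : K)] [V.IsCharNeTwoNF] in
/-- If `d = s²` in `E`, then `ι(√d) = ± s` in `K̄_E`, so every `σ ∈ Γ_E` FIXES `ι(√d)`. [folklore] -/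
theorem smul_closureEmb_geomSqrt_eq {s : E} (hs : s ^ 2 = algebraMap K E d)
    (σ : absoluteGaloisGroup E) :
    (show AlgebraicClosure E ≃ₐ[E] AlgebraicClosure E from σ) (closureEmb (K := K) E (geomSqrt d)) =
      closureEmb (K := K) E (geomSqrt d) := by
  have hsq : (closureEmb (K := K) E (geomSqrt d)) ^ 2 =
      (algebraMap E (AlgebraicClosure E) s) ^ 2 := by
    rw [← map_pow, geomSqrt_sq, AlgHom.commutes, ← map_pow, hs,
      ← IsScalarTower.algebraMap_apply]
  rcases sq_eq_sq_iff_eq_or_eq_neg.mp hsq with h | h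
  · rw [h]
    exact (show AlgebraicClosure E ≃ₐ[E] AlgebraicClosure E from σ).commutes s
  · rw [h, map_neg]
    exact congrArg Neg.neg ((show AlgebraicClosure E ≃ₐ[E] AlgebraicClosure E from σ).commutes s)

end LocalUntwist

/-! ## §2 The untwisting over `K̄`: `Γ_K`-equivariant up to sign, hence equivariant on `E[2]` -/

section GlobalUntwist

variable {K : Type u} [Field K] [NeZero (2 : K)] {W Wd V : WeierstrassCurve K} [V.IsCharNeTwoNF]
  {d : K} (hd : d ≠ 0) {C C₀ : VariableChange K} (hWd : C • W.quadraticTwist d = Wd) (hV : C₀ • W = V)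
  (hVW : W.quadraticTwist d = V.quadraticTwist d)

/-- **The untwisting `E^{(d)}(K̄) ≃+ E(K̄)` commutes with `σ ∈ Γ_K` when `σ√d = √d`** (the chain: undo the
model `C`, transport to the normal form `V`, untwist by `u = √d` (`untwistEquiv`), undo `C₀`; every link but
the untwisting is `Γ_K`-equivariant, and the untwisting is when `σ` fixes `√d`).
[cite: SilvermanAEC2009, X.5 Cor. 5.4] -/
theorem untwistChain_smul_of_eq (σ : absoluteGaloisGroup K) (hσ : σ • geomSqrt d = geomSqrt d)
    (P : geomPoints Wd) :
    (twistPointsIso hV).symm (untwistEquiv V hd (geomPointsCongr hVW ((twistPointsIso hWd).symm (σ • P)))) =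
      σ • (twistPointsIso hV).symm (untwistEquiv V hd (geomPointsCongr hVW ((twistPointsIso hWd).symm P))) := by
  rw [symm_equivariant (twistPointsIso hWd) (twistPointsIso_smul hWd) σ P, geomPointsCongr_smul,
    untwistEquiv_smul_of_eq V hd σ hσ, symm_equivariant (twistPointsIso hV) (twistPointsIso_smul hV) σ]

/-- **… and anti-commutes (`f(σP) = -σ f(P)`) when `σ√d = -√d`.** [cite: SilvermanAEC2009, X.5 Cor. 5.4] -/
theorem untwistChain_smul_of_eq_neg (σ : absoluteGaloisGroup K) (hσ : σ • geomSqrt d = -geomSqrt d)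
    (P : geomPoints Wd) :
    (twistPointsIso hV).symm (untwistEquiv V hd (geomPointsCongr hVW ((twistPointsIso hWd).symm (σ • P)))) =
      -(σ • (twistPointsIso hV).symm (untwistEquiv V hd (geomPointsCongr hVW ((twistPointsIso hWd).symm P)))) := by
  rw [symm_equivariant (twistPointsIso hWd) (twistPointsIso_smul hWd) σ P, geomPointsCongr_smul,
    untwistEquiv_smul_of_eq_neg V hd σ hσ, map_neg,
    symm_equivariant (twistPointsIso hV) (twistPointsIso_smul hV) σ]

end GlobalUntwist

section TorsionTwo

variable {K : Type u} [Field K] {X Y : WeierstrassCurve K}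

/-- **An isomorphism `E'(K̄) ≃+ E(K̄)` that is `Γ_K`-equivariant UP TO SIGN restricts to a `Γ_K`-EQUIVARIANT
isomorphism `E'[2] ≃+ E[2]`** (`-Q = Q` on `2`-torsion; Mazur–Rubin 2010, Remark 2.4: `E^F[2] = E[2]`). After
gk2-p4's `exists_equivariant_addEquiv_geomTorsion_two_of_twist`, keeping track of the underlying map.
[cite: MazurRubin2010, Remark 2.4] -/
theorem exists_addEquiv_geomTorsion_two_of_sign (e : geomPoints X ≃+ geomPoints Y)
    (hsign : ∀ (g : absoluteGaloisGroup K) (Q : geomPoints X), e (g • Q) = g • e Q ∨ e (g • Q) = -(g • e Q)) :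
    ∃ ψ : geomTorsion X (2 : ℤ) ≃+ geomTorsion Y (2 : ℤ),
      (∀ (g : absoluteGaloisGroup K) (t : geomTorsion X (2 : ℤ)), ψ (g • t) = g • ψ t) ∧
        ∀ t : geomTorsion X (2 : ℤ), (ψ t : geomPoints Y) = e t := by
  have hmem : ∀ Q : geomPoints X, Q ∈ geomTorsion X (2 : ℤ) → e Q ∈ geomTorsion Y (2 : ℤ) :=
    fun Q hQ ↦ by
    rw [mem_geomTorsion_iff, ← map_zsmul, (mem_geomTorsion_iff X (2 : ℤ) Q).mp hQ, map_zero]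
  have hmem' : ∀ P : geomPoints Y, P ∈ geomTorsion Y (2 : ℤ) → e.symm P ∈ geomTorsion X (2 : ℤ) :=
    fun P hP ↦ by
    rw [mem_geomTorsion_iff, ← map_zsmul, (mem_geomTorsion_iff Y (2 : ℤ) P).mp hP, map_zero]
  let ψ : geomTorsion X (2 : ℤ) ≃+ geomTorsion Y (2 : ℤ) :=
    { toFun := fun t ↦ ⟨e t.1, hmem t.1 t.2⟩
      invFun := fun s ↦ ⟨e.symm s.1, hmem' s.1 s.2⟩
      left_inv := fun t ↦ Subtype.ext (e.symm_apply_apply t.1)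
      right_inv := fun s ↦ Subtype.ext (e.apply_symm_apply s.1)
      map_add' := fun a b ↦ Subtype.ext (by simp only [AddSubgroup.coe_add, map_add]) }
  refine ⟨ψ, fun g t ↦ Subtype.ext ?_, fun t ↦ rfl⟩
  change e ((g • t : geomTorsion X (2 : ℤ)) : geomPoints X) = ((g • (ψ t) : geomTorsion Y (2 : ℤ)) : geomPoints Y)
  rw [Literature.NumberTheory.EllipticCurves.AddSubgroup.torsionBy.coe_smul,
    Literature.NumberTheory.EllipticCurves.AddSubgroup.torsionBy.coe_smul]
  change e (g • (t : geomPoints X)) = g • e (t : geomPoints X)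
  rcases hsign g t with h | h
  · exact h
  · rw [h]
    have h2 : (2 : ℤ) • (g • e (t : geomPoints X)) = 0 := by
      have hcomm := map_zsmul (DistribSMul.toAddMonoidHom (geomPoints Y) g) (2 : ℤ) (e (t : geomPoints X))
      change g • ((2 : ℤ) • e (t : geomPoints X)) = (2 : ℤ) • (g • e (t : geomPoints X)) at hcomm
      rw [← hcomm, ← map_zsmul e, (mem_geomTorsion_iff X (2 : ℤ) _).mp t.2, map_zero, smul_zero]
    rw [two_zsmul] at h2
    exact neg_eq_of_add_eq_zero_left h2

end TorsionTwo

/-! ## §3 The untwisting over `K̄_E`: formula, `Γ_E`-equivariance when `d ∈ (E^×)²`, and the local square -/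

section LocalChain

variable {K : Type u} [Field K] [NeZero (2 : K)] (V : WeierstrassCurve K) [V.IsCharNeTwoNF] {d : K}
  (hd : d ≠ 0) (E : Type u) [Field E] [Algebra K E]

omit [NeZero (2 : K)] [V.IsCharNeTwoNF] in
/-- New `x`-coordinate under `ι(C_θ)`: `x' = x / ι(θ)²`. [folklore] -/
theorem toX_untwist_map (x : AlgebraicClosure E) :
    ((untwist hd).map (closureEmb (K := K) E : AlgebraicClosure K →+* AlgebraicClosure E)).toX x =
      (closureEmb (K := K) E (geomSqrt d) ^ 2)⁻¹ * x := by
  simp [VariableChange.toX_def, untwist, VariableChange.map, Units.val_inv_eq_inv_val, inv_pow]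

omit [NeZero (2 : K)] [V.IsCharNeTwoNF] in
/-- New `y`-coordinate under `ι(C_θ)`: `y' = y / ι(θ)³`. [folklore] -/
theorem toY_untwist_map (x y : AlgebraicClosure E) :
    ((untwist hd).map (closureEmb (K := K) E : AlgebraicClosure K →+* AlgebraicClosure E)).toY x y =
      (closureEmb (K := K) E (geomSqrt d) ^ 3)⁻¹ * y := by
  simp [VariableChange.toY_def, untwist, VariableChange.map, Units.val_inv_eq_inv_val, inv_pow]

/-- **The local untwisting `E^{(d)}(K̄_E) ≃+ E(K̄_E)` on an affine point: `(x, y) ↦ (x/ι(θ)², y/ι(θ)³)`.**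
[cite: SilvermanAEC2009, X.5 Cor. 5.4] -/
theorem localUntwist_some {x y : AlgebraicClosure E}
    (h : ((V.quadraticTwist d).baseChange (AlgebraicClosure E)).toAffine.Nonsingular x y) :
    ∃ h', ((VariableChange.pointEquiv ((V.quadraticTwist d).baseChange (AlgebraicClosure E))
        ((untwist hd).map (closureEmb (K := K) E : AlgebraicClosure K →+* AlgebraicClosure E))).trans
        (Affine.Point.congrEquiv (untwist_map_closureEmb_smul V hd E))) (.some x y h) =
      (.some ((closureEmb (K := K) E (geomSqrt d) ^ 2)⁻¹ * x)
        ((closureEmb (K := K) E (geomSqrt d) ^ 3)⁻¹ * y) h' : (V.baseChange (AlgebraicClosure E)).toAffine.Point) := by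
  have h' : (V.baseChange (AlgebraicClosure E)).toAffine.Nonsingular
      ((closureEmb (K := K) E (geomSqrt d) ^ 2)⁻¹ * x) ((closureEmb (K := K) E (geomSqrt d) ^ 3)⁻¹ * y) := by
    rw [← toX_untwist_map hd E x, ← toY_untwist_map hd E x y, ← untwist_map_closureEmb_smul V hd E,
      VariableChange.nonsingular_iff]
    exact h
  refine ⟨h', ?_⟩
  rw [AddEquiv.trans_apply, VariableChange.pointEquiv_some, Affine.Point.congrEquiv_some]
  simp only [Affine.Point.some.injEq]
  exact ⟨toX_untwist_map hd E x, toY_untwist_map hd E x y⟩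

omit [NeZero (2 : K)] [V.IsCharNeTwoNF] in
/-- The `Γ_E`-action on an affine point of `X(K̄_E)` is the action on its coordinates
(`localPoints.smul_def` with Mathlib's `Affine.Point.map_some`). [folklore] -/
theorem localPoints_smul_some (X : WeierstrassCurve K) (σ : absoluteGaloisGroup E) {x y : AlgebraicClosure E}
    (h : (X.baseChange (AlgebraicClosure E)).toAffine.Nonsingular x y) :
    ∃ h', σ • (show localPoints X E from .some x y h) =
      (show localPoints X E from
        .some ((show AlgebraicClosure E ≃ₐ[E] AlgebraicClosure E from σ) x)
          ((show AlgebraicClosure E ≃ₐ[E] AlgebraicClosure E from σ) y) h') :=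
  ⟨_, rfl⟩

omit [NeZero (2 : K)] [V.IsCharNeTwoNF] in
/-- The map on points along `ι : K̄ → K̄_E` on an affine point: `ι_*(x, y) = (ι x, ι y)`. [folklore] -/
theorem pointsMap_some (X : WeierstrassCurve K) {x y : AlgebraicClosure K}
    (h : (X.baseChange (AlgebraicClosure K)).toAffine.Nonsingular x y) :
    ∃ h', pointsMap X E (show geomPoints X from .some x y h) =
      (show localPoints X E from .some (closureEmb (K := K) E x) (closureEmb (K := K) E y) h') :=
  ⟨_, rfl⟩

omit [NeZero (2 : K)] [V.IsCharNeTwoNF] in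
/-- **A local untwisting is `Γ_E`-equivariant as soon as `d` is a square in `E`.** Any additive isomorphism
`L : E^{(d)}(K̄_E) ≃+ E(K̄_E)` given on affine points by `(x, y) ↦ (x/ι(θ)², y/ι(θ)³)` (e.g. the substitution
`ι(C_θ)`, `localUntwist_some`) commutes with `Γ_E`: `ι θ = ± s` is fixed by `Γ_E` when `d = s²` in `E`.
[cite: SilvermanAEC2009, X.5 Cor. 5.4] -/
theorem localUntwist_smul (L : localPoints (V.quadraticTwist d) E ≃+ localPoints V E)
    (hL : ∀ (x y : AlgebraicClosure E)
      (h : ((V.quadraticTwist d).baseChange (AlgebraicClosure E)).toAffine.Nonsingular x y),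
      ∃ h', L (show localPoints (V.quadraticTwist d) E from .some x y h) =
        (show localPoints V E from .some ((closureEmb (K := K) E (geomSqrt d) ^ 2)⁻¹ * x)
          ((closureEmb (K := K) E (geomSqrt d) ^ 3)⁻¹ * y) h'))
    {s : E} (hs : s ^ 2 = algebraMap K E d) (σ : absoluteGaloisGroup E)
    (Q : localPoints (V.quadraticTwist d) E) : L (σ • Q) = σ • L Q := by
  have hfix := smul_closureEmb_geomSqrt_eq E hs σ
  change ((V.quadraticTwist d).baseChange (AlgebraicClosure E)).toAffine.Point at Q
  rcases Q with _ | ⟨x, y, h⟩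
  · rw [← Affine.Point.zero_def]
    change L (σ • (0 : localPoints (V.quadraticTwist d) E)) = σ • L (0 : localPoints (V.quadraticTwist d) E)
    rw [smul_zero, map_zero, smul_zero]
  · obtain ⟨h₁, e₁⟩ := localPoints_smul_some E (V.quadraticTwist d) σ h
    obtain ⟨h₂, e₂⟩ := hL _ _ h₁
    obtain ⟨h₃, e₃⟩ := hL x y h
    obtain ⟨h₄, e₄⟩ := localPoints_smul_some E V σ h₃
    change L (σ • (show localPoints (V.quadraticTwist d) E from .some x y h)) =
      σ • L (show localPoints (V.quadraticTwist d) E from .some x y h)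
    rw [e₁, e₂, e₃, e₄]
    simp only [map_mul, map_inv₀, map_pow, hfix]

/-! ## §4 The local square: untwisting over `K̄` and over `K̄_E` commute with the maps on points along `ι` -/

/-- **`ι_* ∘ (untwisting over K̄) = (untwisting over K̄_E) ∘ ι_*` on the nose** (both are `(x,y) ↦ (x/θ², y/θ³)`,
with `θ` resp. `ι θ`). [cite: SilvermanAEC2009, X.5 Cor. 5.4] -/
theorem pointsMap_untwistEquiv (L : localPoints (V.quadraticTwist d) E ≃+ localPoints V E)
    (hL : ∀ (x y : AlgebraicClosure E)
      (h : ((V.quadraticTwist d).baseChange (AlgebraicClosure E)).toAffine.Nonsingular x y),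
      ∃ h', L (show localPoints (V.quadraticTwist d) E from .some x y h) =
        (show localPoints V E from .some ((closureEmb (K := K) E (geomSqrt d) ^ 2)⁻¹ * x)
          ((closureEmb (K := K) E (geomSqrt d) ^ 3)⁻¹ * y) h'))
    (R : geomPoints (V.quadraticTwist d)) :
    pointsMap V E (untwistEquiv V hd R) = L (pointsMap (V.quadraticTwist d) E R) := by
  change ((V.quadraticTwist d).baseChange (AlgebraicClosure K)).toAffine.Point at R
  rcases R with _ | ⟨x, y, h⟩
  · rw [← Affine.Point.zero_def]
    change pointsMap V E (untwistEquiv V hd (0 : geomPoints (V.quadraticTwist d))) =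
      L (pointsMap (V.quadraticTwist d) E (0 : geomPoints (V.quadraticTwist d)))
    rw [map_zero, map_zero, map_zero, map_zero]
  · obtain ⟨h₁, e₁⟩ := untwistEquiv_some V hd h
    obtain ⟨h₂, e₂⟩ := pointsMap_some E V h₁
    obtain ⟨h₃, e₃⟩ := pointsMap_some E (V.quadraticTwist d) h
    obtain ⟨h₄, e₄⟩ := hL _ _ h₃
    change pointsMap V E (untwistEquiv V hd (show geomPoints (V.quadraticTwist d) from .some x y h)) =
      L (pointsMap (V.quadraticTwist d) E (show geomPoints (V.quadraticTwist d) from .some x y h))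
    rw [e₁, e₂, e₃, e₄]
    simp only [map_mul, map_inv₀, map_pow]

end LocalChain

/-! ## §5 Mazur–Rubin Lemma 2.10 (i): at a place where `d` is a square the relaxed local conditions correspond -/

section Main

variable {K : Type u} [Field K]

/-- Symmetric form of the tree's local square `pointsMap_twistPointsIso`. [folklore] -/
theorem pointsMap_twistPointsIso_symm {W₁ W₂ : WeierstrassCurve K} {C : VariableChange K} (hC : C • W₁ = W₂)
    (E : Type u) [Field E] [Algebra K E] (P : geomPoints W₂) :
    pointsMap W₁ E ((twistPointsIso hC).symm P) = (twistLocalIso E hC).symm (pointsMap W₂ E P) := by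
  apply (twistLocalIso E hC).injective
  rw [AddEquiv.apply_symm_apply, ← pointsMap_twistPointsIso, AddEquiv.apply_symm_apply]

variable [NeZero (2 : K)]

/-- **MAZUR–RUBIN LEMMA 2.10 (i) in tree currency: at a place where `d` is a square, `E` and EVERY model of
`E^{(d)}` have the SAME relaxed local `2`-Selmer condition.** For `W/K` (`2 ≠ 0`), `d ≠ 0` and any model
`Wd = C • W^{(d)}` of the quadratic twist there is a `Γ_K`-equivariant isomorphism `ψ : Wd[2] ≃+ W[2]`
(Mazur–Rubin 2010 Remark 2.4, `E^F[2] = E[2]`; Silverman X.5 Cor. 5.4 restricted to `2`-torsion, where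
`-Q = Q`) such that, for EVERY `K`-field `E` in which `d` is a square (a completion `K_v` at a place `v` SPLIT
in `K(√d)/K`), a class `x ∈ H¹(K, Wd[2])` satisfies the local Selmer condition of `Wd` at `E`
(`x ↦ 0 ∈ H¹(E, Wd(K̄_E))`, the tree's `selmerLocalKer`) iff its image `h1Equiv ψ x ∈ H¹(K, W[2])` satisfies
that of `W`: «if `v` splits in `F/K` then `H¹_f(K_v, E[2]) = H¹_f(K_v, E^F[2])`». Proof: over `K̄_E ∋ ι(√d) = ± s`
the untwisting substitution is `Γ_E`-equivariant on ALL of `Wd(K̄_E)` (`localUntwist_smul`) and intertwines the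
maps on points along `ι` (`pointsMap_untwistEquiv`), so the tree's `mem_resKer_iff_h1Equiv_mem` applies. The
first finite-place brick of the arithmetic instantiation of `QuadraticSelmerStructure` for `(E, E^{(d)})`
(`MazurRubin2010.prop33_rat` / `cor34i_singleton_rat` / T-A / T-V of the cell): in the cell's twisting fields
every bad prime, the prime `2`, and (on `Δ < 0`, by gk2-p3's archimedean vanishing) the real place are such places.
[cite: MazurRubin2010, Remark 2.4 and Lemma 2.10 (i)] [cite: SilvermanAEC2009, X.5 Cor. 5.4, X.§4] -/
theorem exists_h1Equiv_selmerLocalKer_iff_of_sq (W : WeierstrassCurve K) {d : K} (hd : d ≠ 0)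
    {Wd : WeierstrassCurve K} {C : VariableChange K} (hWd : C • W.quadraticTwist d = Wd) :
    ∃ (ψ : geomTorsion Wd (2 : ℤ) ≃+ geomTorsion W (2 : ℤ))
      (hψ : ∀ (g : absoluteGaloisGroup K) (t : geomTorsion Wd (2 : ℤ)), ψ (g • t) = g • ψ t),
      ∀ (E : Type u) [Field E] [Algebra K E], (∃ s : E, s ^ 2 = algebraMap K E d) →
        ∀ x : Wd.galH1Torsion (2 : ℤ),
          x ∈ Wd.selmerLocalKer E (2 : ℤ) ↔ h1Equiv ψ hψ x ∈ W.selmerLocalKer E (2 : ℤ) := by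
  letI : Invertible (2 : K) := invertibleOfNonzero two_ne_zero
  set C₀ : VariableChange K := W.toCharNeTwoNF with hC₀
  set V : WeierstrassCurve K := C₀ • W with hVdef
  haveI : V.IsCharNeTwoNF := by rw [hVdef, hC₀]; infer_instance
  have hV : C₀ • W = V := rfl
  have hVW : W.quadraticTwist d = V.quadraticTwist d := by
    rw [hVdef, quadraticTwist_smul]
    have h1 : (⟨C₀.u, d * C₀.r, 0, 0⟩ : VariableChange K) = 1 := by
      simp only [hC₀, toCharNeTwoNF, mul_zero]
      rfl
    rw [h1, one_smul]
  -- the global untwisting `Wd(K̄) ≃+ W(K̄)` and its `Γ_K`-equivariant restriction to `2`-torsion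
  set eG : geomPoints Wd ≃+ geomPoints W :=
    (((twistPointsIso hWd).symm.trans (geomPointsCongr hVW)).trans (untwistEquiv V hd)).trans
      (twistPointsIso hV).symm with heG
  have hsign : ∀ (g : absoluteGaloisGroup K) (Q : geomPoints Wd),
      eG (g • Q) = g • eG Q ∨ eG (g • Q) = -(g • eG Q) := fun g Q ↦ by
    rcases map_geomSqrt (absoluteGaloisGroup.toAlgEquiv K g) d with h | h
    · exact Or.inl (untwistChain_smul_of_eq hd hWd hV hVW g h Q)
    · exact Or.inr (untwistChain_smul_of_eq_neg hd hWd hV hVW g h Q)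
  obtain ⟨ψ, hψ, hψe⟩ := exists_addEquiv_geomTorsion_two_of_sign eG hsign
  refine ⟨ψ, hψ, fun E _ _ ⟨s, hs⟩ x ↦ ?_⟩
  -- the local untwisting `Wd(K̄_E) ≃+ W(K̄_E)`, `Γ_E`-equivariant since `d = s²` in `E`
  set L : localPoints (V.quadraticTwist d) E ≃+ localPoints V E :=
    (show localPoints (V.quadraticTwist d) E ≃+ localPoints V E from
      (VariableChange.pointEquiv ((V.quadraticTwist d).baseChange (AlgebraicClosure E))
          ((untwist hd).map (closureEmb (K := K) E : AlgebraicClosure K →+* AlgebraicClosure E))).trans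
        (Affine.Point.congrEquiv (untwist_map_closureEmb_smul V hd E))) with hL
  have hLsome : ∀ (x y : AlgebraicClosure E)
      (h : ((V.quadraticTwist d).baseChange (AlgebraicClosure E)).toAffine.Nonsingular x y),
      ∃ h', L (show localPoints (V.quadraticTwist d) E from .some x y h) =
        (show localPoints V E from .some ((closureEmb (K := K) E (geomSqrt d) ^ 2)⁻¹ * x)
          ((closureEmb (K := K) E (geomSqrt d) ^ 3)⁻¹ * y) h') :=
    fun x y h ↦ localUntwist_some V hd E h
  set eL : localPoints Wd E ≃+ localPoints W E :=
    (((twistLocalIso E hWd).symm.trans (localPointsCongr E hVW)).trans L).trans (twistLocalIso E hV).symm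
    with heL
  have heLsmul : ∀ (σ : absoluteGaloisGroup E) (Q : localPoints Wd E), eL (σ • Q) = σ • eL Q := fun σ Q ↦ by
    simp only [heL, AddEquiv.trans_apply]
    rw [symm_equivariant (twistLocalIso E hWd) (twistLocalIso_smul E hWd) σ Q, localPointsCongr_smul,
      localUntwist_smul V E L hLsome hs σ,
      symm_equivariant (twistLocalIso E hV) (twistLocalIso_smul E hV) σ]
  -- the square: `ι_* ∘ eG = eL ∘ ι_*` on `Wd(K̄)`, in particular on `Wd[2]`
  have hsqP : ∀ P : geomPoints Wd, pointsMap W E (eG P) = eL (pointsMap Wd E P) := fun P ↦ by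
    simp only [heG, heL, AddEquiv.trans_apply]
    rw [pointsMap_twistPointsIso_symm hV E, pointsMap_untwistEquiv V hd E L hLsome,
      pointsMap_geomPointsCongr E hVW, pointsMap_twistPointsIso_symm hWd E]
  have hsq : ∀ t : geomTorsion Wd (2 : ℤ),
      ((pointsMap W E).comp (geomTorsion W (2 : ℤ)).subtype) (ψ t) =
        eL (((pointsMap Wd E).comp (geomTorsion Wd (2 : ℤ)).subtype) t) := fun t ↦ by
    simp only [AddMonoidHom.coe_comp, Function.comp_apply, AddSubgroup.coe_subtype]
    rw [hψe t]
    exact hsqP t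
  exact mem_resKer_iff_h1Equiv_mem (resGal (K := K) E)
    ((pointsMap Wd E).comp (geomTorsion Wd (2 : ℤ)).subtype)
    (fun σ P ↦ by
      simp only [AddMonoidHom.coe_comp, AddSubgroup.coe_subtype, Function.comp_apply,
        Literature.NumberTheory.EllipticCurves.AddSubgroup.torsionBy.coe_smul]
      exact pointsMap_smul Wd E σ P)
    ((pointsMap W E).comp (geomTorsion W (2 : ℤ)).subtype)
    (fun σ P ↦ by
      simp only [AddMonoidHom.coe_comp, AddSubgroup.coe_subtype, Function.comp_apply,
        Literature.NumberTheory.EllipticCurves.AddSubgroup.torsionBy.coe_smul]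
      exact pointsMap_smul W E σ P)
    ψ hψ eL heLsmul hsq x

end Main

end Summit.BirchSwinnertonDyer.BirchSwinnertonDyer.Theorems.GenusKolyTwistLocal

end
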